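import Literature.NumberTheory.EllipticCurves.FormalGroupKummerPointProofs
import Mathlib.GroupTheory.Index
import HarnessLib

/-!
# The filtration of the kernel of reduction and division by `n` in the formal group

Topic `NumberTheory/EllipticCurves`. Let `(F, w)` be a valued field (`w : Valuation F ℝ≥0`) and `V`
a Weierstrass equation with `w`-integral coefficients, `E₁ = FormalGroupChart.kernel w V` its kernel of
reduction and `z = -x/y` the local parameter at `O` (file `FormalGroupChart`: `z` is an isometric
injection of `E₁` into the maximal ideal, `|z(P + Q) - z(P) - z(Q)| ≤ max(|z P|, |z Q|)²`).
This file supplies the part of Silverman, *The Arithmetic of Elliptic Curves*, IV.3 / IV.6 /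
VII.2.2 and of the proof of Prop. VII.6.3 ("`E(K)` contains a subgroup of finite index isomorphic
to `R⁺`") that concerns the formal group alone, in the chart language of the tree (no power
series):

* `kernelLevel w V r` — **the filtration** `E₁ ⊇ ⋯ ⊇ {P ∈ E₁ : |z(P)| ≤ r} ⊇ ⋯` by subgroups
  (Silverman IV.3.2: `Ê(𝓜) ⊇ Ê(𝓜²) ⊇ ⋯`; VII.2.2: `E₁(K) ≅ Ê(𝓜)`);
* `eq_zero_of_nsmul_eq_zero` — **no torsion strictly below the level `|p|`**, from the tree's
  `|z(n P)| = |n| |z(P)|` below that level (`val_zCoord_nsmul_eq`, file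
  `FormalGroupKummerPointProofs`; Silverman IV.2.3 `[n](T) = nT + ⋯`, IV.3.2(b), Thm. IV.6.1 /
  VII.3.1 in the weak form "no torsion at all strictly below level `|p|`", valid at every place,
  also for `v ∣ n`);
* `exists_nsmul_eq_of_val_le_mul` — **division by `N` in the formal group over a complete field**:
  if `|z(T)| ≤ |N| ρ` with `ρ < |N|` then `T = N • Q` with `|z(Q)| ≤ ρ`, by successive approximation
  (`Q ↦ z⁻¹(z(T)/N)` improves the level by the factor `ρ/|N| < 1`; Silverman IV.6.4(b) proves the
  corresponding statement `[p] : Ê(𝓜ʳ) ≅ Ê(𝓜ʳ⁺ᵉ)`-type isomorphism through the formal logarithm),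
  granted (i) every `a` with `|a| ≤ ρ` is a parameter `z(P)`, `P ∈ E₁` (Hensel, supplied by the
  consumer) and (ii) geometric Cauchy sequences of `F` converge (completeness);
* `exists_quotientMap_kernelLevel`, `relIndex_kernelLevel_eq` — **the graded pieces are those of
  the maximal ideal**: `z` induces an injection of coset spaces `H/(H ∩ U_s) ↪ B_t/B_s` for every
  `H ≤ E₁` with `z(H) ⊆ B_t` (`B_t = {a : |a| ≤ t}`, Mathlib `Valuation.leAddSubgroup`), bijective for
  `H = U_r` granted (i) (Silverman IV.3.2(a): `Ê(𝓜ʳ)/Ê(𝓜ʳ⁺¹) ≅ 𝓜ʳ/𝓜ʳ⁺¹`);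
* `map_nsmul_kernelLevel_eq`, `map_nsmul_kernelLevel_eq_of_prime` — **`n · U_r = U_{|n| r}` for
  `0 < r < |p|`** (`p` the residue characteristic, i.e. every integer prime to `p` is a `w`-unit),
  granted (i) and (ii); with the previous item, `[U_r : n U_r] = [B_r : B_{|n| r}]`
  (`relIndex_map_nsmul_kernelLevel_eq`), which over a finite extension of `ℚ_p` is `(R : nR)` —
  the count in Silverman VII.6.3 / Milne, *Arithmetic Duality Theorems*, I Lemma 3.3, completed
  in the companion file `LocalPointsIntegersSubgroup` for the completions of a number field.

The estimates `|z(N Q) - N z(Q)| ≤ |z(Q)|²` (`val_zCoord_nsmul`, file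
`IwasawaSelmerControlAwayFromPProofs`) and `|z(n Q)| = |n| |z(Q)|` (`val_zCoord_nsmul_eq_of_lt`,
`val_zCoord_nsmul_eq`, file `FormalGroupKummerPointProofs`) of the tree are reused, not restated.

## References

* [SilvermanAEC2009] J. H. Silverman, *The Arithmetic of Elliptic Curves*, 2nd ed., GTM 106 (2009):
  IV.2.3, IV.3.2, IV.6.1, IV.6.4, VII.2.2, VII.3.1, VII.6.3.
* [MilneADT2006] J. S. Milne, *Arithmetic Duality Theorems*, 2nd ed. (2006), I Lemma 3.3.

## Design

`noncomputable section`, `open scoped Classical NNReal`; one definition (`kernelLevel`, an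
`AddSubgroup`), everything else theorems; the analytic inputs (i), (ii) are hypotheses
(`hlift`, `hcomplete`) discharged by the consumers. Axioms: `propext`, `Classical.choice`,
`Quot.sound`.
-/

noncomputable section

open scoped Classical NNReal

namespace Literature.NumberTheory.EllipticCurves

namespace FormalGroupChart

universe u

variable {F : Type u} [Field F]

/-! ### The filtration `U_r = {P ∈ E₁ : |z(P)| ≤ r}` -/

section Level

variable (w : Valuation F ℝ≥0) (V : WeierstrassCurve F) [hV : V.IsIntegral w.integer]

/-- **The filtration of the kernel of reduction**: for `r : ℝ≥0`, the subgroup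
`U_r = {P ∈ E₁ : |z(P)| ≤ r}` of the kernel of reduction `E₁ = kernel w V` (a subgroup by
`|z(P + Q)| ≤ max(|z P|, |z Q|)` and `|z(-P)| = |z P|`). For the valuation ring `R` of a local field
with maximal ideal `𝓜 = (π)` and `r = |π|ⁿ` this is Silverman's `Ê(𝓜ⁿ) ≅ E_n(K)`
(*AEC* IV.3.2, VII.2.2; `U_1 = E₁`, `kernelLevel_one`). [cite: SilvermanAEC2009, Prop. IV.3.2 and Prop. VII.2.2] -/
def kernelLevel (r : ℝ≥0) : AddSubgroup V.toAffine.Point where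
  carrier := {P | P ∈ kernel w V ∧ w P.zCoord ≤ r}
  zero_mem' := ⟨(kernel w V).zero_mem, by
    rw [WeierstrassCurve.Affine.Point.zCoord_zero, map_zero]; exact zero_le⟩
  add_mem' := fun {P Q} hP hQ ↦ ⟨(kernel w V).add_mem hP.1 hQ.1,
    (val_zCoord_add_le hP.1 hQ.1).trans (max_le hP.2 hQ.2)⟩
  neg_mem' := fun {P} hP ↦ ⟨(kernel w V).neg_mem hP.1, by rw [val_zCoord_neg hP.1]; exact hP.2⟩

variable {w V}

/-- Membership in `U_r`. [folklore] -/
theorem mem_kernelLevel_iff {r : ℝ≥0} {P : V.toAffine.Point} :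
    P ∈ kernelLevel w V r ↔ P ∈ kernel w V ∧ w P.zCoord ≤ r := Iff.rfl

/-- `U_r ≤ E₁`. [folklore] -/
theorem kernelLevel_le_kernel (r : ℝ≥0) : kernelLevel w V r ≤ kernel w V := fun _ h ↦ h.1

/-- The filtration is monotone in the level. [folklore] -/
theorem kernelLevel_mono {s r : ℝ≥0} (h : s ≤ r) : kernelLevel w V s ≤ kernelLevel w V r :=
  fun _ hP ↦ ⟨hP.1, hP.2.trans h⟩

/-- `U_1 = E₁` (`|z| < 1` on the kernel of reduction). [cite: SilvermanAEC2009, Prop. VII.2.2] -/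
theorem kernelLevel_one : kernelLevel w V 1 = kernel w V :=
  le_antisymm (kernelLevel_le_kernel 1) fun _ hP ↦ ⟨hP, (val_zCoord_lt_one hP).le⟩

end Level

/-! ### Multiplication by `n` on `E₁`: no torsion below the level `|p|`, `N • U_r ⊆ U_{|N| r}` -/

section NSMul

variable {w : Valuation F ℝ≥0} {V : WeierstrassCurve F} [hV : V.IsIntegral w.integer]

/-- **No torsion strictly below the level `|p|`**: if every integer prime to the prime `p` is a
`w`-unit and `F` has characteristic zero, a point `Q ∈ E₁` with `|z(Q)| < |p|` and `n Q = O`,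
`n ≠ 0`, is `O` (`|n| |z(Q)| = |z(O)| = 0` with `|n| ≠ 0`). Silverman, *AEC* IV.3.2(b) with Thm.
IV.6.1 / Prop. VII.3.1 (which bound the level of torsion more precisely by `|p|^{1/(p-1)}`).
[cite: SilvermanAEC2009, Prop. IV.3.2, Thm. IV.6.1 and Prop. VII.3.1] -/
theorem eq_zero_of_nsmul_eq_zero [CharZero F] {p : ℕ} (hp : p.Prime)
    (hunit : ∀ n : ℕ, ¬ p ∣ n → w (n : F) = 1) {n : ℕ} (hn : n ≠ 0) {Q : V.toAffine.Point}
    (hQ : Q ∈ kernel w V) (hQp : w Q.zCoord < w (p : F)) (h : n • Q = 0) : Q = 0 := by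
  have key := val_zCoord_nsmul_eq (w := w) (V := V) hp hunit n hn hQ hQp
  rw [h, WeierstrassCurve.Affine.Point.zCoord_zero, map_zero] at key
  have hn0 : w (n : F) ≠ 0 := by
    rw [Ne, Valuation.zero_iff]; exact Nat.cast_ne_zero.mpr hn
  have hz : w Q.zCoord = 0 := by
    rcases mul_eq_zero.mp key.symm with h0 | h0
    · exact absurd h0 hn0
    · exact h0
  rw [Valuation.zero_iff] at hz
  exact (zCoord_eq_zero_iff (w := w) (V := V) hQ).mp hz

/-- `N • U_r ⊆ U_{|N| r}` for `r < |N|`. [cite: SilvermanAEC2009, Prop. IV.3.2] -/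
theorem nsmul_mem_kernelLevel_mul (N : ℕ) {r : ℝ≥0} (hr : r < w (N : F)) {Q : V.toAffine.Point}
    (hQ : Q ∈ kernelLevel w V r) : N • Q ∈ kernelLevel w V (w (N : F) * r) := by
  refine ⟨(kernel w V).nsmul_mem hQ.1 N, ?_⟩
  rw [val_zCoord_nsmul_eq_of_lt N hQ.1 (hQ.2.trans_lt hr)]
  exact mul_le_mul' le_rfl hQ.2

end NSMul

/-! ### Division by `N` over a complete field (successive approximation) -/

section Division

variable {w : Valuation F ℝ≥0} {V : WeierstrassCurve F} [hV : V.IsIntegral w.integer]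

/-- **Division by `N` in the formal group over a complete field.** Let `|N| = c > 0` and
`0 < ρ < c`, and assume: (i) every `a ∈ F` with `|a| ≤ ρ` is the parameter `z(P)` of some
`P ∈ E₁` (Hensel's lemma for the consumer's complete field), and (ii) every sequence `(x_k)` in
`F` with `|x_{k+1} - x_k| ≤ C θᵏ`, `θ < 1`, has a limit `y` with `|y - x_k| ≤ C θᵏ` (completeness).
Then **every `T ∈ E₁` with `|z(T)| ≤ c ρ` is `N • Q` for some `Q ∈ E₁` with `|z(Q)| ≤ ρ`.**
Proof: successive approximation with ratio `θ = ρ/c < 1` — from a residual `T'` with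
`|z(T')| ≤ c ρ θᵏ` pass to `T' - N • Q`, `Q = z⁻¹(z(T')/N)`, of parameter
`|z(T') - z(N Q)| = |N z(Q) - z(N Q)| ≤ |z(Q)|² ≤ (ρ θᵏ)² ≤ c ρ θᵏ⁺¹`; the partial sums of the
`Q`'s have Cauchy parameters (`|z(S + Q) - z(S)| = |z(Q)|`), their limit `y` is a parameter
`z(P)` by (i), and `T - N • P` has parameter `≤ ρ θᵏ` for every `k`, hence is `O`. (Silverman,
*AEC* IV.6.4(b), proves `Ê(𝓜ʳ) ≅ 𝓜ʳ`-statements of this kind with the formal logarithm; the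
present chart version needs no power series; the case `|N| = 1` over an intermediate layer
`K_n ⊆ L` is `exists_nsmul_eq_of_complete` of `IwasawaSelmerControlAwayFromPProofs`.)
[cite: SilvermanAEC2009, Thm. IV.6.4 and Prop. VII.2.2] -/
theorem exists_nsmul_eq_of_val_le_mul {N : ℕ} {c ρ : ℝ≥0} (hc : w (N : F) = c) (hc0 : 0 < c)
    (hρc : ρ < c)
    (hlift : ∀ a : F, w a ≤ ρ → ∃ P ∈ kernel w V, P.zCoord = a)
    (hcomplete : ∀ (x : ℕ → F) (C θ : ℝ≥0), θ < 1 → (∀ k, w (x (k + 1) - x k) ≤ C * θ ^ k) →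
      ∃ y : F, ∀ k, w (y - x k) ≤ C * θ ^ k)
    {T : V.toAffine.Point} (hT : T ∈ kernel w V) (hTz : w T.zCoord ≤ c * ρ) :
    ∃ Q ∈ kernel w V, w Q.zCoord ≤ ρ ∧ N • Q = T := by
  set θ : ℝ≥0 := ρ / c with hθ
  have hθ1 : θ < 1 := (div_lt_one hc0).mpr hρc
  have hθ1' : θ ≤ 1 := hθ1.le
  have hρθ : ρ = θ * c := by rw [hθ, div_mul_cancel₀ ρ hc0.ne']
  have hN0 : (N : F) ≠ 0 := by
    intro h
    rw [h, map_zero] at hc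
    exact hc0.ne hc
  have hc1 : c ≤ 1 := hc ▸ val_natCast_le_one w N
  have hρ1 : ρ ≤ 1 := hρc.le.trans hc1
  -- the invariant of the recursion at level `k`: residual `s.1`, partial sum `s.2`
  let Inv : ℕ → V.toAffine.Point × V.toAffine.Point → Prop := fun k s ↦
    s.1 ∈ kernel w V ∧ s.2 ∈ kernel w V ∧ w s.1.zCoord ≤ c * ρ * θ ^ k ∧ w s.2.zCoord ≤ ρ ∧
      T = s.1 + N • s.2
  have hInv0 : Inv 0 (T, 0) := by
    refine ⟨hT, (kernel w V).zero_mem, by rwa [pow_zero, mul_one], ?_, ?_⟩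
    · change w (0 : V.toAffine.Point).zCoord ≤ ρ
      rw [WeierstrassCurve.Affine.Point.zCoord_zero, map_zero]; exact zero_le
    · change T = T + N • (0 : V.toAffine.Point)
      rw [smul_zero, add_zero]
  -- the step
  have hstep : ∀ (k : ℕ) (s : {s // Inv k s}), ∃ s' : {s' // Inv (k + 1) s'},
      w (s'.1.2.zCoord - s.1.2.zCoord) ≤ ρ * θ ^ k := by
    rintro k ⟨⟨T', S⟩, hT'K, hSK, hT'z, hSz, hTS⟩
    dsimp only at hT'K hSK hT'z hSz hTS
    set b : F := T'.zCoord / (N : F) with hb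
    have hbw : w b ≤ ρ * θ ^ k := by
      rw [hb, map_div₀, hc, div_le_iff₀ hc0]
      calc w T'.zCoord ≤ c * ρ * θ ^ k := hT'z
        _ = ρ * θ ^ k * c := by ring
    have hbρ : w b ≤ ρ :=
      hbw.trans (mul_le_of_le_one_right' (pow_le_one₀ zero_le hθ1'))
    obtain ⟨Q, hQK, hQz⟩ := hlift b hbρ
    have hQρ : w Q.zCoord ≤ ρ := by rw [hQz]; exact hbρ
    have hNQK : N • Q ∈ kernel w V := (kernel w V).nsmul_mem hQK N
    refine ⟨⟨(T' - N • Q, S + Q), (kernel w V).sub_mem hT'K hNQK, (kernel w V).add_mem hSK hQK,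
      ?_, ?_, ?_⟩, ?_⟩
    · -- the new residual
      change w (T' - N • Q).zCoord ≤ c * ρ * θ ^ (k + 1)
      rw [← val_zCoord_sub hT'K hNQK]
      have e : T'.zCoord - (N • Q).zCoord = -((N • Q).zCoord - (N : F) * Q.zCoord) := by
        rw [hQz, hb, mul_div_cancel₀ _ hN0]; ring
      rw [e, Valuation.map_neg]
      calc w ((N • Q).zCoord - (N : F) * Q.zCoord) ≤ w Q.zCoord ^ 2 :=
            (val_zCoord_nsmul (w := w) N hQK).2.2
        _ ≤ (ρ * θ ^ k) ^ 2 := by rw [hQz]; gcongr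
        _ = c * ρ * θ ^ (k + 1) * θ ^ k := by rw [hρθ]; ring
        _ ≤ c * ρ * θ ^ (k + 1) * 1 := by gcongr; exact pow_le_one₀ zero_le hθ1'
        _ = c * ρ * θ ^ (k + 1) := mul_one _
    · change w (S + Q).zCoord ≤ ρ
      exact (val_zCoord_add_le hSK hQK).trans (max_le hSz hQρ)
    · change T = (T' - N • Q) + N • (S + Q)
      rw [hTS, smul_add]
      abel
    · change w ((S + Q).zCoord - S.zCoord) ≤ ρ * θ ^ k
      rw [val_zCoord_add_sub_eq hSK hQK, hQz]
      exact hbw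
  choose next hnext using hstep
  -- the sequence of approximations and the Cauchy property of the partial sums' parameters
  let seq : ∀ k : ℕ, {s // Inv k s} := fun k ↦ Nat.rec ⟨(T, 0), hInv0⟩ (fun k s ↦ next k s) k
  have hseq_succ : ∀ k, seq (k + 1) = next k (seq k) := fun k ↦ rfl
  have hseq_zero : (seq 0).1.2 = 0 := rfl
  have hcauchy : ∀ k, w ((seq (k + 1)).1.2.zCoord - (seq k).1.2.zCoord) ≤ ρ * θ ^ k := by
    intro k
    rw [hseq_succ]
    exact hnext k (seq k)
  obtain ⟨y, hy⟩ := hcomplete (fun k ↦ (seq k).1.2.zCoord) ρ θ hθ1 hcauchy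
  have hy0 : w y ≤ ρ := by
    have h := hy 0
    rw [hseq_zero, WeierstrassCurve.Affine.Point.zCoord_zero, sub_zero, pow_zero, mul_one] at h
    exact h
  obtain ⟨P, hPK, hPz⟩ := hlift y hy0
  refine ⟨P, hPK, by rw [hPz]; exact hy0, ?_⟩
  -- `D = T - N • P` has arbitrarily small parameter
  have hNPK : N • P ∈ kernel w V := (kernel w V).nsmul_mem hPK N
  have hDK : T - N • P ∈ kernel w V := (kernel w V).sub_mem hT hNPK
  have hDsmall : ∀ k, w (T - N • P).zCoord ≤ ρ * θ ^ k := by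
    intro k
    obtain ⟨hT'K, hSK, hT'z, -, hTS⟩ := (seq k).2
    have hSPK : (seq k).1.2 - P ∈ kernel w V := (kernel w V).sub_mem hSK hPK
    have hNSPK : N • ((seq k).1.2 - P) ∈ kernel w V := (kernel w V).nsmul_mem hSPK N
    have eD : T - N • P = (seq k).1.1 + N • ((seq k).1.2 - P) := by
      conv_lhs => rw [hTS]
      rw [smul_sub]
      abel
    rw [eD]
    refine (val_zCoord_add_le hT'K hNSPK).trans (max_le ?_ ?_)
    · calc w (seq k).1.1.zCoord ≤ c * ρ * θ ^ k := hT'z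
        _ ≤ 1 * ρ * θ ^ k := by gcongr
        _ = ρ * θ ^ k := by rw [one_mul]
    · calc w (N • ((seq k).1.2 - P)).zCoord ≤ w ((seq k).1.2 - P).zCoord :=
            (val_zCoord_nsmul (w := w) N hSPK).2.1
        _ = w ((seq k).1.2.zCoord - P.zCoord) := (val_zCoord_sub hSK hPK).symm
        _ = w (y - (seq k).1.2.zCoord) := by rw [hPz, ← Valuation.map_neg, neg_sub]
        _ ≤ ρ * θ ^ k := hy k
  have hDz : (T - N • P).zCoord = 0 := by
    by_contra h0
    have hpos : 0 < w (T - N • P).zCoord := (Valuation.pos_iff w).mpr h0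
    obtain ⟨k, hk⟩ := exists_pow_lt_of_lt_one hpos hθ1
    exact lt_irrefl _ (((hDsmall k).trans (mul_le_of_le_one_left' hρ1)).trans_lt hk)
  have hD0 := (zCoord_eq_zero_iff (w := w) (V := V) hDK).mp hDz
  rw [sub_eq_zero] at hD0
  exact hD0.symm

/-- **`N • U_ρ = U_{|N| ρ}` over a complete field** for `0 < ρ < |N|`: `⊆` by
`|z(N Q)| = |N| |z(Q)|` (`val_zCoord_nsmul_eq_of_lt`), `⊇` by `exists_nsmul_eq_of_val_le_mul` (hypotheses (i), (ii) as there).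
Silverman, *AEC* IV.3.2, IV.6.4(b). [cite: SilvermanAEC2009, Prop. IV.3.2 and Thm. IV.6.4] -/
theorem map_nsmul_kernelLevel_eq {N : ℕ} {ρ : ℝ≥0} (hρN : ρ < w (N : F))
    (hlift : ∀ a : F, w a ≤ ρ → ∃ P ∈ kernel w V, P.zCoord = a)
    (hcomplete : ∀ (x : ℕ → F) (C θ : ℝ≥0), θ < 1 → (∀ k, w (x (k + 1) - x k) ≤ C * θ ^ k) →
      ∃ y : F, ∀ k, w (y - x k) ≤ C * θ ^ k) :
    (kernelLevel w V ρ).map (nsmulAddMonoidHom N) = kernelLevel w V (w (N : F) * ρ) := by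
  have hc0 : 0 < w (N : F) := lt_of_le_of_lt zero_le hρN
  refine le_antisymm ?_ ?_
  · rintro _ ⟨Q, hQ, rfl⟩
    exact nsmul_mem_kernelLevel_mul N hρN hQ
  · rintro T ⟨hTK, hTz⟩
    obtain ⟨Q, hQK, hQz, hQT⟩ := exists_nsmul_eq_of_val_le_mul (w := w) (V := V) rfl hc0 hρN hlift
      hcomplete hTK hTz
    exact ⟨Q, ⟨hQK, hQz⟩, hQT⟩

/-- **`n • U_ρ = U_{|n| ρ}` for every `n ≠ 0` and `0 < ρ < |p|`**, `p` the residue characteristic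
(every integer prime to `p` is a `w`-unit), over a complete field in which the parameters of level
`≤ ρ` are realised: induction on the `p`-adic valuation of `n`, composing the statements of
`map_nsmul_kernelLevel_eq` for the factor `p` at the levels `ρ, |p| ρ, |p|² ρ, …` (all `< |p|`) and
for the prime-to-`p` factor (of absolute value `1 > ρ`). Silverman, *AEC* IV.3.2, IV.6.4(b).
[cite: SilvermanAEC2009, Prop. IV.3.2 and Thm. IV.6.4] -/
theorem map_nsmul_kernelLevel_eq_of_prime {p : ℕ} (hp : p.Prime)
    (hunit : ∀ n : ℕ, ¬ p ∣ n → w (n : F) = 1)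
    (hcomplete : ∀ (x : ℕ → F) (C θ : ℝ≥0), θ < 1 → (∀ k, w (x (k + 1) - x k) ≤ C * θ ^ k) →
      ∃ y : F, ∀ k, w (y - x k) ≤ C * θ ^ k) :
    ∀ {n : ℕ}, n ≠ 0 → ∀ {ρ : ℝ≥0}, ρ < w (p : F) →
      (∀ a : F, w a ≤ ρ → ∃ P ∈ kernel w V, P.zCoord = a) →
      (kernelLevel w V ρ).map (nsmulAddMonoidHom n) = kernelLevel w V (w (n : F) * ρ) := by
  intro n
  induction n using Nat.strong_induction_on with
  | _ n ih =>
    intro hn ρ hρp hlift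
    have hp1 : w (p : F) ≤ 1 := val_natCast_le_one w p
    by_cases hpn : p ∣ n
    · obtain ⟨m, rfl⟩ := hpn
      have hm : m ≠ 0 := by rintro rfl; exact hn (mul_zero p)
      have hmlt : m < p * m := lt_mul_left (Nat.pos_of_ne_zero hm) hp.one_lt
      -- `(p m) • Q = m • (p • Q)`
      have hcomp : (nsmulAddMonoidHom (p * m) : V.toAffine.Point →+ V.toAffine.Point) =
          (nsmulAddMonoidHom m).comp (nsmulAddMonoidHom p) := by
        ext Q
        simp only [nsmulAddMonoidHom_apply, AddMonoidHom.coe_comp, Function.comp_apply]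
        rw [mul_nsmul]
      have hρ' : w (p : F) * ρ < w (p : F) := by
        calc w (p : F) * ρ ≤ 1 * ρ := by gcongr
          _ = ρ := one_mul _
          _ < w (p : F) := hρp
      have hlift' : ∀ a : F, w a ≤ w (p : F) * ρ → ∃ P ∈ kernel w V, P.zCoord = a :=
        fun a ha ↦ hlift a (ha.trans (by
          calc w (p : F) * ρ ≤ 1 * ρ := by gcongr
            _ = ρ := one_mul _))
      rw [hcomp, ← AddSubgroup.map_map, map_nsmul_kernelLevel_eq hρp hlift hcomplete,
        ih m hmlt hm hρ' hlift', Nat.cast_mul, map_mul]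
      congr 1
      ring
    · have hn1 : w (n : F) = 1 := hunit n hpn
      have hρn : ρ < w (n : F) := by rw [hn1]; exact hρp.trans_le hp1
      exact map_nsmul_kernelLevel_eq hρn hlift hcomplete

end Division

/-! ### The graded pieces: `z` identifies `U_r/U_s` with `B_r/B_s` -/

section Cosets

variable {w : Valuation F ℝ≥0} {V : WeierstrassCurve F} [hV : V.IsIntegral w.integer]

/-- **The class of a point of `E₁` modulo `U_s` is the class of its parameter modulo the ball
`B_s = {a : |a| ≤ s}`**: for a subgroup `H ≤ E₁` whose parameters lie in `B_t`, the map
`H/(H ∩ U_s) → B_t/B_s`, `[P] ↦ [z(P)]`, is well defined and injective, because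
`P - Q ∈ U_s ⟺ |z(P - Q)| ≤ s ⟺ |z(P) - z(Q)| ≤ s` (`z` is an isometry, `val_zCoord_sub`).
Silverman, *AEC* IV.3.2(a) (`Ê(𝓜ʳ)/Ê(𝓜ʳ⁺¹) ↪ 𝓜ʳ/𝓜ʳ⁺¹`). Produced existentially: no definition
is introduced. [cite: SilvermanAEC2009, Prop. IV.3.2] -/
theorem exists_quotientMap_kernelLevel {H : AddSubgroup V.toAffine.Point} (hH : H ≤ kernel w V)
    {t : ℝ≥0} (hHt : ∀ P ∈ H, w (WeierstrassCurve.Affine.Point.zCoord P) ≤ t) (s : ℝ≥0) :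
    ∃ f : H ⧸ (kernelLevel w V s).addSubgroupOf H →
        (w.leAddSubgroup t) ⧸ (w.leAddSubgroup s).addSubgroupOf (w.leAddSubgroup t),
      Function.Injective f ∧
      ∀ P : H, f (P : H ⧸ (kernelLevel w V s).addSubgroupOf H) =
        ((⟨(P : V.toAffine.Point).zCoord, hHt P P.2⟩ : w.leAddSubgroup t) :
          (w.leAddSubgroup t) ⧸ (w.leAddSubgroup s).addSubgroupOf (w.leAddSubgroup t)) := by
  -- the map on representatives
  let g : H → w.leAddSubgroup t := fun P ↦ ⟨(P : V.toAffine.Point).zCoord, hHt P P.2⟩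
  -- the two coset relations agree along `g`
  have key : ∀ P Q : H,
      (QuotientAddGroup.leftRel ((kernelLevel w V s).addSubgroupOf H)) P Q ↔
        (QuotientAddGroup.leftRel ((w.leAddSubgroup s).addSubgroupOf (w.leAddSubgroup t)))
          (g P) (g Q) := by
    intro P Q
    rw [QuotientAddGroup.leftRel_apply, QuotientAddGroup.leftRel_apply,
      AddSubgroup.mem_addSubgroupOf, AddSubgroup.mem_addSubgroupOf, mem_kernelLevel_iff,
      Valuation.mem_leAddSubgroup_iff]
    have hPK : (P : V.toAffine.Point) ∈ kernel w V := hH P.2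
    have hQK : (Q : V.toAffine.Point) ∈ kernel w V := hH Q.2
    have hmem : ((-P + Q : H) : V.toAffine.Point) ∈ kernel w V := hH (-P + Q).2
    have e1 : ((-P + Q : H) : V.toAffine.Point) = (Q : V.toAffine.Point) - P := by
      push_cast; abel
    have e2 : ((-g P + g Q : w.leAddSubgroup t) : F) =
        (Q : V.toAffine.Point).zCoord - (P : V.toAffine.Point).zCoord := by
      push_cast
      change -(P : V.toAffine.Point).zCoord + (Q : V.toAffine.Point).zCoord = _
      abel
    rw [e1, e2, val_zCoord_sub hQK hPK]
    exact ⟨fun h ↦ h.2, fun h ↦ ⟨e1 ▸ hmem, h⟩⟩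
  refine ⟨Quotient.map' g (fun P Q h ↦ (key P Q).mp h), ?_, fun P ↦ rfl⟩
  intro x y hxy
  induction x using QuotientAddGroup.induction_on with
  | H P =>
  induction y using QuotientAddGroup.induction_on with
  | H Q =>
  have h' : (QuotientAddGroup.leftRel ((w.leAddSubgroup s).addSubgroupOf (w.leAddSubgroup t)))
      (g P) (g Q) := Quotient.exact' hxy
  exact Quotient.sound' ((key P Q).mpr h')

/-- **`[H : H ∩ U_s]` is finite when `B_t/B_s` is** (`H ≤ E₁` with parameters in `B_t`), by the
injection of `exists_quotientMap_kernelLevel`. In particular the filtration of `E₁` has finite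
steps over a local field. [cite: SilvermanAEC2009, Prop. IV.3.2] -/
theorem relIndex_kernelLevel_ne_zero {H : AddSubgroup V.toAffine.Point} (hH : H ≤ kernel w V)
    {t : ℝ≥0} (hHt : ∀ P ∈ H, w (WeierstrassCurve.Affine.Point.zCoord P) ≤ t) (s : ℝ≥0)
    [Finite ((w.leAddSubgroup t) ⧸ (w.leAddSubgroup s).addSubgroupOf (w.leAddSubgroup t))] :
    (kernelLevel w V s).relIndex H ≠ 0 := by
  obtain ⟨f, hf, -⟩ := exists_quotientMap_kernelLevel hH hHt s
  haveI : Finite (H ⧸ (kernelLevel w V s).addSubgroupOf H) := Finite.of_injective f hf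
  rw [AddSubgroup.relIndex]
  exact AddSubgroup.index_ne_zero_of_finite

/-- **`[U_r : U_s] = [B_r : B_s]`** for `s ≤ r`, granted that every `a` with `|a| ≤ r` is a
parameter `z(P)`, `P ∈ E₁` (then the injection of `exists_quotientMap_kernelLevel` for `H = U_r`,
`t = r` is onto). Silverman, *AEC* IV.3.2(a): `Ê(𝓜ʳ)/Ê(𝓜ʳ⁺¹) ≅ 𝓜ʳ/𝓜ʳ⁺¹`.
[cite: SilvermanAEC2009, Prop. IV.3.2] -/
theorem relIndex_kernelLevel_eq {s r : ℝ≥0}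
    (hlift : ∀ a : F, w a ≤ r → ∃ P ∈ kernel w V, P.zCoord = a) :
    (kernelLevel w V s).relIndex (kernelLevel w V r) =
      (w.leAddSubgroup s).relIndex (w.leAddSubgroup r) := by
  obtain ⟨f, hf, hfmk⟩ := exists_quotientMap_kernelLevel (w := w) (V := V)
    (H := kernelLevel w V r) (kernelLevel_le_kernel r) (t := r) (fun P hP ↦ hP.2) s
  have hsurj : Function.Surjective f := by
    intro y
    induction y using QuotientAddGroup.induction_on with
    | H a =>
    obtain ⟨P, hPK, hPz⟩ := hlift a a.2
    have hPr : P ∈ kernelLevel w V r := ⟨hPK, by rw [hPz]; exact a.2⟩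
    refine ⟨((⟨P, hPr⟩ : kernelLevel w V r) : _ ⧸ _), ?_⟩
    rw [hfmk]
    congr 1
    exact Subtype.ext hPz
  rw [AddSubgroup.relIndex, AddSubgroup.relIndex, AddSubgroup.index, AddSubgroup.index]
  exact Nat.card_congr (Equiv.ofBijective f ⟨hf, hsurj⟩)

/-- **`[U_ρ : n U_ρ] = [B_ρ : B_{|n| ρ}]`** for `n ≠ 0` and `0 < ρ < |p|` (`p` the residue
characteristic), over a complete field realising the parameters of level `≤ ρ`: combine
`map_nsmul_kernelLevel_eq_of_prime` (`n U_ρ = U_{|n| ρ}`) and `relIndex_kernelLevel_eq`. Over a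
finite extension of `ℚ_p` with valuation ring `R` the right-hand side is `(R : nR)`: this is the
count "`[A(K)⁽ⁿ⁾]/[A(K)ₙ] = (R : nR)^{dim A}`" of Milne, *ADT* I Lemma 3.3 / the subgroup
"isomorphic to `R⁺`" of Silverman, *AEC* VII.6.3, on the formal group.
[cite: SilvermanAEC2009, Prop. VII.6.3] [cite: MilneADT2006, I Lemma 3.3] -/
theorem relIndex_map_nsmul_kernelLevel_eq {p : ℕ} (hp : p.Prime)
    (hunit : ∀ n : ℕ, ¬ p ∣ n → w (n : F) = 1)
    (hcomplete : ∀ (x : ℕ → F) (C θ : ℝ≥0), θ < 1 → (∀ k, w (x (k + 1) - x k) ≤ C * θ ^ k) →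
      ∃ y : F, ∀ k, w (y - x k) ≤ C * θ ^ k)
    {n : ℕ} (hn : n ≠ 0) {ρ : ℝ≥0} (hρp : ρ < w (p : F))
    (hlift : ∀ a : F, w a ≤ ρ → ∃ P ∈ kernel w V, P.zCoord = a) :
    ((kernelLevel w V ρ).map (nsmulAddMonoidHom n)).relIndex (kernelLevel w V ρ) =
      (w.leAddSubgroup (w (n : F) * ρ)).relIndex (w.leAddSubgroup ρ) := by
  rw [map_nsmul_kernelLevel_eq_of_prime hp hunit hcomplete hn hρp hlift]
  exact relIndex_kernelLevel_eq hlift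

end Cosets

end FormalGroupChart

end Literature.NumberTheory.EllipticCurves

end
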